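import Literature.NumberTheory.EllipticCurves.IsogenyRationalPointsBaseChangeProofs
import Literature.NumberTheory.EllipticCurves.IrreducibleModPQuadraticTwistProofs
import Summits.BirchSwinnertonDyer.Rank1Residual.X11b.BDPRouteManin
import Summits.BirchSwinnertonDyer.Rank1Residual.X12.CMIsogenyInvariance
import Summits.BirchSwinnertonDyer.Rank1Residual.X2.IsogenyClassStability
import Summits.BirchSwinnertonDyer.Rank1Residual.Additive.GordTorsionAnomalous
import Summits.BirchSwinnertonDyer.BirchSwinnertonDyer.Theorems.EdixhovenFibreFiveSevenTwistDegreeStepFiveSevenAddvUnitTwist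
import HarnessLib

/-!
# TORS-TWIST at `p ∈ {5, 7}`: a unit quadratic twist by a NON-RESIDUE kills the `ℚ_p`-rational
# `p`-torsion of an additive isogeny class (route `EdixhovenFibreFiveSeven`, crux TDS57, `--supports`)

Cell `pub/bsd-wall` (D-0145 line `route-BirchSwinnertonDyer-EdixhovenFibreFiveSeven`), seat `bsd-line-edix-p2`
(prover). Route-free file: THEOREMS ONLY (no definition, no named fact, no `sorry`); it does not import the route's
Theses file. BSD is not proved by this file.

This is the input (TORS-TWIST) `hTT` of the landed conditional theorem
`TwistDegreeStepFiveSevenKP.twistDegreeStepFiveSeven_of_kato_of_twistInputs : F″ → L-TWIST → TORS-TWIST → TDS57`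
(`Theorems/EdixhovenFibreFiveSevenTwistDegreeStepFiveSevenKP.lean`), in the form the call site uses it
(`p ∈ {5, 7}`, the optimal member `V₀` additive at `p`):

* `exists_pointHom_padic_eq_zero_imp` — an isogeny `φ : E → E'` over `ℚ` of degree prime to `p` acts on
  `ℚ_p`-points by a homomorphism `φ_p : E(ℚ_p) → E'(ℚ_p)` (the tree's Galois descent
  `Isogeny.exists_pointHom_baseChange_eq`) that is INJECTIVE ON `p`-TORSION (its kernel lies in `E[φ]`, of
  order `deg φ`);
* `exists_prime_smul_eq_zero_of_isIsogenous` — hence, for `E[p]` irreducible, a `ℚ_p`-rational point of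
  order `p` anywhere in the `ℚ`-isogeny class of `V₀` gives one ON `V₀` (a cyclic `ℚ`-isogeny onto `V₀` has
  degree prime to `p`, `X11b.not_dvd_degree_of_isCyclic_of_irr`);
* `false_of_residues_five`, `false_of_residues_seven` — the arithmetic core: the forced residues
  `c₄ ≡ −5 (mod 25)` resp. `c₆ ≡ 7 (mod 49)` (tree: `Additive.sq_dvd_c₄_add_or_c₆_sub_of_prime_zsmul_eq_zero_of_addv`,
  Mazur's Step 1 one order deeper) cannot hold simultaneously for `c₄` and `w⁴ d² c₄` (resp. `c₆` and
  `w⁶ d³ c₆`) when `d` is a non-square mod `5` (resp. `7`) — `x⁴ ≡ 1 (5)`, `x⁶ ≡ 1 (7)` for units, while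
  `d² ≡ −1 (5)`, `d³ ≡ −1 (7)` (Euler);
* **`torsTwist57`** — for `p ∈ {5, 7}`, `V₀/ℚ` globally minimal, additive at `p`, `E[p]` irreducible, `q ≠ p`
  a prime with `q* = (−1)^{(q−1)/2} q` a non-square mod `p`, a `ℚ_p`-rational point of order `p` somewhere in
  the class of `V₀`, and `Vχ` any globally minimal model of `V₀ ⊗ χ_{q*}`: NO curve `ℚ`-isogenous to `Vχ` has a
  `ℚ_p`-rational point of order `p`;
* `torsTwist57_input` — the same packaged in the binder shape of `hTT` restricted to `p ∈ {5, 7}` and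
  `Addv V₀ p` (the shape consumed by the sibling closing file).

Proof of `torsTwist57`: transport the torsion point to `V₀` and (arguing by contradiction) the one on the
twisted side to `Vχ` (irreducibility is twist-invariant: `hasIrreducibleModPGaloisRep_quadraticTwist_iff`;
additivity of the unit twist: `AddvUnitTwist.addv_of_model_twist_auxPrime`); read the residues of `c₄(V₀)`,
`c₄(Vχ)` (resp. `c₆`) forced by the two torsion points; `c₄(Vχ) = w⁴ (q*)² c₄(V₀)`, `c₆(Vχ) = w⁶ (q*)³ c₆(V₀)`
with `w = u(v)⁻¹ ∈ ℚ^×` (Mathlib `variableChange_c₄/₆`, tree `quadraticTwist_c₄/₆`); contradiction by the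
arithmetic core. (The Galois-module proof — `E[p]|_{G_{ℚ_p}}` an extension of `ω` by `1`, twisted by the
unramified quadratic character — is replaced by this explicit residue computation, which the tree already
holds.)

References: [Mazur1977] Ch. III §5, Step 1, p. 158; [SilvermanAEC2009] III.4 (Cor. III.4.9, III.4.11),
VII.5 Prop. 5.1, VIII.§1, X.5 Cor. 5.4; [KostersPannekoek2017] Thm. 1, Cor. 2 (the locus of `p`-torsion at
additive reduction, context).
-/

set_option autoImplicit false
-- the Theorems directory repeats the summit name (sibling precedent `SignedBaseChangeAssembly.lean`)
set_option linter.dupNamespace false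

noncomputable section

open scoped Classical

open WeierstrassCurve Literature.NumberTheory.EllipticCurves
  Literature.NumberTheory.EllipticCurves.Rank1Residual
  Summit.BirchSwinnertonDyer.Rank1Residual Summit.BirchSwinnertonDyer.Rank1Residual.Additive
  Summit.BirchSwinnertonDyer.BirchSwinnertonDyer.Theorems

namespace Summit.BirchSwinnertonDyer.BirchSwinnertonDyer.Theorems.TorsTwist

/-! ### §1 Prime-to-`p` isogenies are injective on `ℚ_p`-rational `p`-torsion -/

/-- **An isogeny of degree prime to `p` is injective on `ℚ_p`-rational `p`-torsion.** For an isogeny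
`φ : E → E'` over `ℚ` with `p ∤ deg φ` there is a homomorphism `φ_p : E(ℚ_p) → E'(ℚ_p)` (Galois descent of
`φ_{ℚ̄_p}`, the tree's `Isogeny.exists_pointHom_baseChange_eq`) such that `p • Q = O`, `φ_p Q = O` force
`Q = O`: `ι Q ∈ ker φ_{ℚ̄_p} = ι_*(E[φ])` (`Isogeny.ker_baseChange_eq_map`), a group of order `deg φ`, so the
order of the preimage divides `gcd(p, deg φ) = 1`. [cite: SilvermanAEC2009, III.4, Cor. 4.9 and VIII.§1] -/
theorem exists_pointHom_padic_eq_zero_imp {p : ℕ} [Fact p.Prime] {W W' : WeierstrassCurve ℚ}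
    (φ : Isogeny W W') (hdeg : ¬ p ∣ φ.degree) :
    ∃ f : (W.baseChange ℚ_[p]).toAffine.Point →+ (W'.baseChange ℚ_[p]).toAffine.Point,
      ∀ Q : (W.baseChange ℚ_[p]).toAffine.Point, (p : ℤ) • Q = 0 → f Q = 0 → Q = 0 := by
  letI : Algebra (AlgebraicClosure ℚ) (AlgebraicClosure ℚ_[p]) :=
    (closureEmb (K := ℚ) ℚ_[p]).toRingHom.toAlgebra
  haveI : IsScalarTower ℚ (AlgebraicClosure ℚ) (AlgebraicClosure ℚ_[p]) :=
    IsScalarTower.of_algebraMap_eq fun x ↦ ((closureEmb (K := ℚ) ℚ_[p]).commutes x).symm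
  obtain ⟨f, hf⟩ := φ.exists_pointHom_baseChange_eq ℚ_[p]
  refine ⟨f, fun Q hpQ hfQ ↦ ?_⟩
  have hker := (φ.pointHom_eq_zero_iff hf Q).mp hfQ
  rw [← AddMonoidHom.mem_ker, φ.ker_baseChange_eq_map, AddSubgroup.mem_map] at hker
  obtain ⟨P₀, hP₀, hP₀Q⟩ := hker
  set ι := Affine.Point.map (W' := W)
    (IsScalarTower.toAlgHom ℚ (AlgebraicClosure ℚ) (AlgebraicClosure ℚ_[p])) with hι
  set j := Affine.Point.baseChange (W' := W) ℚ_[p] (AlgebraicClosure ℚ_[p]) with hj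
  have hinj : Function.Injective ι := Affine.Point.map_injective _
  have e2 : ι P₀ = j Q := hP₀Q
  -- `p • P₀ = O` by injectivity of `ℚ̄ → ℚ̄_p` on points
  have hpP₀ : (p : ℤ) • P₀ = 0 := by
    apply hinj
    calc ι ((p : ℤ) • P₀) = (p : ℤ) • ι P₀ := map_zsmul ι p P₀
      _ = (p : ℤ) • j Q := congrArg (fun x ↦ (p : ℤ) • x) e2
      _ = j ((p : ℤ) • Q) := (map_zsmul j p Q).symm
      _ = j 0 := congrArg j hpQ
      _ = 0 := map_zero j
      _ = ι 0 := (map_zero ι).symm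
  -- the order of `P₀` divides `p` and `deg φ`
  have h1 : addOrderOf P₀ ∣ p := by
    apply addOrderOf_dvd_of_nsmul_eq_zero
    rw [← natCast_zsmul]; exact hpP₀
  have h2 : addOrderOf P₀ ∣ φ.degree := AddSubgroup.addOrderOf_dvd_natCard _ hP₀
  have h3 : addOrderOf P₀ = 1 :=
    Nat.eq_one_of_dvd_coprimes ((Nat.Prime.coprime_iff_not_dvd Fact.out).mpr hdeg) h1 h2
  rw [AddMonoid.addOrderOf_eq_one_iff] at h3
  apply baseChange_algebraicClosure_injective W ℚ_[p]
  calc j Q = ι P₀ := e2.symm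
    _ = ι 0 := congrArg ι h3
    _ = 0 := map_zero ι
    _ = j 0 := (map_zero j).symm

/-- **A `ℚ_p`-rational point of order `p` anywhere in the class gives one on every member with `E[p]`
irreducible.** For `W ∼ W'` over `ℚ` (elliptic), `E[p]` irreducible, and `P ∈ W'(ℚ_p)` with `P ≠ O`,
`p • P = O`: there is `P₀ ∈ W(ℚ_p)` with `P₀ ≠ O`, `p • P₀ = O` — push `P` along a cyclic `ℚ`-isogeny
`W' → W`, whose degree is prime to `p` (`X11b.not_dvd_degree_of_isCyclic_of_irr`), with §1.
[cite: SilvermanAEC2009, III.4 (Prop. III.4.12, Cor. III.4.9, Cor. III.6.4(b))] -/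
theorem exists_prime_smul_eq_zero_of_isIsogenous {p : ℕ} [Fact p.Prime] {W W' : WeierstrassCurve ℚ}
    [W.IsElliptic] [W'.IsElliptic] (hirr : Irr W p) (hiso : IsIsogenous W W')
    {P : (W'.baseChange ℚ_[p]).toAffine.Point} (hP0 : P ≠ 0) (hP : (p : ℤ) • P = 0) :
    ∃ P₀ : (W.baseChange ℚ_[p]).toAffine.Point, P₀ ≠ 0 ∧ (p : ℤ) • P₀ = 0 := by
  have hirr' : Irr W' p := (X12.irr_iff_of_isIsogenous hiso p).mp hirr
  obtain ⟨ψ, hψ⟩ := hiso.symm_of_charZero.exists_isCyclic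
  have hdeg : ¬ p ∣ ψ.degree := X11b.not_dvd_degree_of_isCyclic_of_irr ψ hψ Fact.out hirr'
  obtain ⟨f, hf⟩ := exists_pointHom_padic_eq_zero_imp ψ hdeg
  refine ⟨f P, fun h0 ↦ hP0 (hf P hP h0), ?_⟩
  rw [← map_zsmul, hP, map_zero]

/-! ### §2 The arithmetic core: the forced residues are incompatible with a non-residue unit twist -/

/-- In `𝔽₅`: `x⁴ = 0 ⟹ x = 0`. [folklore] -/
theorem zmod5_eq_zero_of_pow_four : ∀ x : ZMod 5, x ^ 4 = 0 → x = 0 := by decide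

/-- In `𝔽₅`: `x ≠ 0 ⟹ x⁴ = 1` (Fermat). [folklore] -/
theorem zmod5_pow_four_eq_one : ∀ x : ZMod 5, x ≠ 0 → x ^ 4 = 1 := by decide

/-- In `𝔽₅`: `d² ∈ {0, 1} ⟹ d` is a square (`d ∈ {0, 1, 4}`). [folklore] -/
theorem zmod5_isSquare_of_sq {d : ZMod 5} (h : d ^ 2 = 0 ∨ d ^ 2 = 1) : IsSquare d := by
  have h' : d = 0 ∨ d = 1 ∨ d = 4 := by revert d; decide
  rcases h' with rfl | rfl | rfl
  · exact ⟨0, by decide⟩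
  · exact ⟨1, by decide⟩
  · exact ⟨2, by decide⟩

/-- In `𝔽₇`: `x⁶ = 0 ⟹ x = 0`. [folklore] -/
theorem zmod7_eq_zero_of_pow_six : ∀ x : ZMod 7, x ^ 6 = 0 → x = 0 := by decide

/-- In `𝔽₇`: `x ≠ 0 ⟹ x⁶ = 1` (Fermat). [folklore] -/
theorem zmod7_pow_six_eq_one : ∀ x : ZMod 7, x ≠ 0 → x ^ 6 = 1 := by decide

/-- In `𝔽₇`: `d³ ∈ {0, 1} ⟹ d` is a square (`d ∈ {0, 1, 2, 4}`; Euler's criterion). [folklore] -/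
theorem zmod7_isSquare_of_cube {d : ZMod 7} (h : d ^ 3 = 0 ∨ d ^ 3 = 1) : IsSquare d := by
  have h' : d = 0 ∨ d = 1 ∨ d = 2 ∨ d = 4 := by revert d; decide
  rcases h' with rfl | rfl | rfl | rfl
  · exact ⟨0, by decide⟩
  · exact ⟨1, by decide⟩
  · exact ⟨3, by decide⟩
  · exact ⟨2, by decide⟩

/-- A rational number is `num / den` with `den ≠ 0` and `gcd(num, den) = 1`; clearing the denominator in
`c' = w^k · e · c`: `c' · den^k = num^k · e · c` in `ℤ`. [folklore] -/
theorem int_eq_of_eq_pow_mul {c c' e : ℤ} (w : ℚ) (k : ℕ) (h : (c' : ℚ) = w ^ k * e * c) :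
    c' * (w.den : ℤ) ^ k = w.num ^ k * e * c := by
  have hden : (w.den : ℚ) ≠ 0 := by exact_mod_cast w.den_nz
  rw [← Rat.num_div_den w] at h
  have h' : (c' : ℚ) * (w.den : ℚ) ^ k = (w.num : ℚ) ^ k * e * c := by
    rw [h, div_pow]
    field_simp
  exact_mod_cast h'

/-- `5 ∣ num` and `5 ∣ den` is impossible for a rational in lowest terms. [folklore] -/
theorem not_dvd_num_den (w : ℚ) {ℓ : ℕ} (hℓ : ℓ ≠ 1) (hn : (ℓ : ℤ) ∣ w.num) (hd : ℓ ∣ w.den) : False :=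
  hℓ (Nat.eq_one_of_dvd_coprimes w.reduced (Int.natCast_dvd.mp hn) hd)

/-- **Arithmetic core at `5`.** If `25 ∣ c + 5`, `25 ∣ c' + 5` and `c' = w⁴ d² c` in `ℚ` (`w ∈ ℚ`, `d ∈ ℤ`),
then `d` is a square mod `5`: writing `w = a/b` in lowest terms, `(5m' − 1) b⁴ = a⁴ d² (5m − 1)`, so mod `5`
`b⁴ = a⁴ d²` with `a⁴, b⁴ ∈ {0, 1}` not both `0`, whence `d² ∈ {0, 1}`. [folklore] -/
theorem isSquare_of_residues_five {c c' d : ℤ} (w : ℚ) (hc : (25 : ℤ) ∣ c + 5) (hc' : (25 : ℤ) ∣ c' + 5)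
    (h : (c' : ℚ) = w ^ 4 * (d : ℚ) ^ 2 * c) : IsSquare ((d : ℤ) : ZMod 5) := by
  obtain ⟨m, hm⟩ := hc
  obtain ⟨m', hm'⟩ := hc'
  have hZ := int_eq_of_eq_pow_mul (c := c) (c' := c') (e := d ^ 2) w 4 (by rw [h]; push_cast; ring)
  -- cancel one factor `5`
  have hZ' : (5 * m' - 1) * (w.den : ℤ) ^ 4 = w.num ^ 4 * d ^ 2 * (5 * m - 1) := by
    have e1 : c = 5 * (5 * m - 1) := by omega
    have e2 : c' = 5 * (5 * m' - 1) := by omega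
    rw [e1, e2] at hZ
    have h5 : (5 : ℤ) ≠ 0 := by norm_num
    have : 5 * ((5 * m' - 1) * (w.den : ℤ) ^ 4) = 5 * (w.num ^ 4 * d ^ 2 * (5 * m - 1)) := by
      linear_combination hZ
    exact mul_left_cancel₀ h5 this
  have hmod := congrArg (Int.cast : ℤ → ZMod 5) hZ'
  push_cast at hmod
  simp only [show (5 : ZMod 5) = 0 from by decide, zero_mul, zero_sub, neg_one_mul, mul_neg_one,
    neg_inj] at hmod
  -- `hmod : den^4 = num^4 * d^2`
  set a : ZMod 5 := (w.num : ZMod 5) with ha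
  set b : ZMod 5 := (w.den : ZMod 5) with hb
  by_cases ha0 : a = 0
  · -- then `b = 0`: `5 ∣ num` and `5 ∣ den`, contradicting lowest terms
    exfalso
    have hb0 : b = 0 := zmod5_eq_zero_of_pow_four b (by rw [hmod, ha0]; ring)
    exact not_dvd_num_den w (ℓ := 5) (by norm_num) ((ZMod.intCast_zmod_eq_zero_iff_dvd w.num 5).mp ha0)
      ((ZMod.natCast_eq_zero_iff w.den 5).mp hb0)
  · have ha4 : a ^ 4 = 1 := zmod5_pow_four_eq_one a ha0
    rw [ha4, one_mul] at hmod
    by_cases hb0 : b = 0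
    · exact zmod5_isSquare_of_sq (Or.inl (by rw [← hmod, hb0]; ring))
    · exact zmod5_isSquare_of_sq (Or.inr (by rw [← hmod]; exact zmod5_pow_four_eq_one b hb0))

/-- **Arithmetic core at `7`.** If `49 ∣ c − 7`, `49 ∣ c' − 7` and `c' = w⁶ d³ c` in `ℚ` (`w ∈ ℚ`, `d ∈ ℤ`),
then `d` is a square mod `7`: in lowest terms `w = a/b`, `(7m' + 1) b⁶ = a⁶ d³ (7m + 1)`, so mod `7`
`b⁶ = a⁶ d³` with `a⁶, b⁶ ∈ {0, 1}` not both `0`, whence `d³ ∈ {0, 1}` (Euler's criterion). [folklore] -/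
theorem isSquare_of_residues_seven {c c' d : ℤ} (w : ℚ) (hc : (49 : ℤ) ∣ c - 7) (hc' : (49 : ℤ) ∣ c' - 7)
    (h : (c' : ℚ) = w ^ 6 * (d : ℚ) ^ 3 * c) : IsSquare ((d : ℤ) : ZMod 7) := by
  obtain ⟨m, hm⟩ := hc
  obtain ⟨m', hm'⟩ := hc'
  have hZ := int_eq_of_eq_pow_mul (c := c) (c' := c') (e := d ^ 3) w 6 (by rw [h]; push_cast; ring)
  have hZ' : (7 * m' + 1) * (w.den : ℤ) ^ 6 = w.num ^ 6 * d ^ 3 * (7 * m + 1) := by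
    have e1 : c = 7 * (7 * m + 1) := by omega
    have e2 : c' = 7 * (7 * m' + 1) := by omega
    rw [e1, e2] at hZ
    have h7 : (7 : ℤ) ≠ 0 := by norm_num
    have : 7 * ((7 * m' + 1) * (w.den : ℤ) ^ 6) = 7 * (w.num ^ 6 * d ^ 3 * (7 * m + 1)) := by
      linear_combination hZ
    exact mul_left_cancel₀ h7 this
  have hmod := congrArg (Int.cast : ℤ → ZMod 7) hZ'
  push_cast at hmod
  simp only [show (7 : ZMod 7) = 0 from by decide, zero_mul, zero_add, one_mul, mul_one] at hmod
  -- `hmod : den^6 = num^6 * d^3`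
  set a : ZMod 7 := (w.num : ZMod 7) with ha
  set b : ZMod 7 := (w.den : ZMod 7) with hb
  by_cases ha0 : a = 0
  · exfalso
    have hb0 : b = 0 := zmod7_eq_zero_of_pow_six b (by rw [hmod, ha0]; ring)
    exact not_dvd_num_den w (ℓ := 7) (by norm_num) ((ZMod.intCast_zmod_eq_zero_iff_dvd w.num 7).mp ha0)
      ((ZMod.natCast_eq_zero_iff w.den 7).mp hb0)
  · have ha6 : a ^ 6 = 1 := zmod7_pow_six_eq_one a ha0
    rw [ha6, one_mul] at hmod
    by_cases hb0 : b = 0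
    · exact zmod7_isSquare_of_cube (Or.inl (by rw [← hmod, hb0]; ring))
    · exact zmod7_isSquare_of_cube (Or.inr (by rw [← hmod]; exact zmod7_pow_six_eq_one b hb0))

/-! ### §3 TORS-TWIST at `p ∈ {5, 7}` -/

/-- **TORS-TWIST at `p ∈ {5, 7}`.** Let `p ∈ {5, 7}`, `V₀/ℚ` globally minimal, additive at `p`, with `E[p]`
irreducible; `q ≠ p` a prime with `d = q* = (−1)^{(q−1)/2} q` a NON-square mod `p`; suppose some curve `W'`
`ℚ`-isogenous to `V₀` has a `ℚ_p`-point `P ≠ O` with `p • P = O`, and let `Vχ` be a globally minimal model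
of the twist `V₀ ⊗ χ_d` (`v • V₀^{(d)} = Vχ`). Then NO curve `W''` `ℚ`-isogenous to `Vχ` has a `ℚ_p`-point
`Q ≠ O` with `p • Q = O`. Transport both torsion points to `V₀`, `Vχ` (§1); both are additive at `p`
(`AddvUnitTwist.addv_of_model_twist_auxPrime`) and globally minimal, so Mazur's Step 1 one order deeper
(`Additive.sq_dvd_c₄_add_or_c₆_sub_of_prime_zsmul_eq_zero_of_addv`) pins `c₄ ≡ −5 (25)` (`p = 5`) resp.
`c₆ ≡ 7 (49)` (`p = 7`) on BOTH; but `c₄(Vχ) = w⁴ d² c₄(V₀)`, `c₆(Vχ) = w⁶ d³ c₆(V₀)` — contradiction with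
`d` a non-residue (§2). [cite: Mazur1977, Ch. III §5, Step 1, p. 158] [cite: SilvermanAEC2009, X.5 Cor. 5.4 and VII.5 Prop. 5.1] -/
theorem torsTwist57 {p : ℕ} [Fact p.Prime] (hp57 : p = 5 ∨ p = 7) {q : ℕ} (hq : q.Prime) (hqp : q ≠ p)
    (V₀ : WeierstrassCurve ℚ) [V₀.IsElliptic] [V₀.IsGloballyMinimal] (hadd : Addv V₀ p) (hirr : Irr V₀ p)
    (hnsq : ¬ IsSquare ((((-1 : ℤ) ^ (q / 2) * q : ℤ)) : ZMod p))
    {W' : WeierstrassCurve ℚ} [W'.IsElliptic] (hisoW' : IsIsogenous V₀ W')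
    {P : (W'.baseChange ℚ_[p]).toAffine.Point} (hP0 : P ≠ 0) (hP : (p : ℤ) • P = 0)
    {Vχ : WeierstrassCurve ℚ} [Vχ.IsElliptic] [Vχ.IsGloballyMinimal] {v : VariableChange ℚ}
    (hv : v • V₀.quadraticTwist (((-1 : ℤ) ^ (q / 2) * q : ℤ) : ℚ) = Vχ)
    {W'' : WeierstrassCurve ℚ} [W''.IsElliptic] (hiso'' : IsIsogenous Vχ W'')
    {Q : (W''.baseChange ℚ_[p]).toAffine.Point} (hQ : (p : ℤ) • Q = 0) : Q = 0 := by
  set d : ℤ := (-1 : ℤ) ^ (q / 2) * q with hd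
  have hp5 : 5 ≤ p := by omega
  have hp2 : p ≠ 2 := by omega
  -- the torsion point moved to `V₀`, and the residue it forces
  obtain ⟨P₀, hP₀0, hP₀⟩ := exists_prime_smul_eq_zero_of_isIsogenous hirr hisoW' hP0 hP
  have hres₀ := sq_dvd_c₄_add_or_c₆_sub_of_prime_zsmul_eq_zero_of_addv V₀ p hp5 hadd hP₀0 hP₀
  by_contra hQ0
  -- the twisted side: `Vχ` is additive at `p` with `E[p]` irreducible
  have haddχ : Addv Vχ p := AddvUnitTwist.addv_of_model_twist_auxPrime hp2 hq hqp hadd ⟨v, hv⟩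
  have hd0 : (d : ℚ) ≠ 0 := by
    rw [hd]; push_cast
    exact mul_ne_zero (pow_ne_zero _ (by norm_num)) (by exact_mod_cast hq.ne_zero)
  have hirrχ : Irr Vχ p := by
    rw [← hv]
    exact (Mazur1978.hasIrreducibleModPGaloisRep_smul_iff _ v p).mpr
      ((V₀.hasIrreducibleModPGaloisRep_quadraticTwist_iff hd0 p).mpr hirr)
  obtain ⟨Q₀, hQ₀0, hQ₀⟩ := exists_prime_smul_eq_zero_of_isIsogenous hirrχ hiso'' hQ0 hQ
  have hresχ := sq_dvd_c₄_add_or_c₆_sub_of_prime_zsmul_eq_zero_of_addv Vχ p hp5 haddχ hQ₀0 hQ₀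
  -- `c₄`, `c₆` of `Vχ` against those of `V₀`
  have hc₄ : Vχ.c₄ = ((v.u⁻¹ : ℚˣ) : ℚ) ^ 4 * (d : ℚ) ^ 2 * V₀.c₄ := by
    rw [← hv, variableChange_c₄, quadraticTwist_c₄]; push_cast; ring
  have hc₆ : Vχ.c₆ = ((v.u⁻¹ : ℚˣ) : ℚ) ^ 6 * (d : ℚ) ^ 3 * V₀.c₆ := by
    rw [← hv, variableChange_c₆, quadraticTwist_c₆]; push_cast; ring
  rw [c₄_eq_intCast_integralModelInt Vχ, c₄_eq_intCast_integralModelInt V₀] at hc₄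
  rw [c₆_eq_intCast_integralModelInt Vχ, c₆_eq_intCast_integralModelInt V₀] at hc₆
  rcases hp57 with rfl | rfl
  · -- `p = 5`: residues of `c₄`
    rcases hres₀ with ⟨-, h₀⟩ | ⟨h, -⟩
    · rcases hresχ with ⟨-, hχ⟩ | ⟨h, -⟩
      · exact hnsq (isSquare_of_residues_five _ h₀ hχ hc₄)
      · omega
    · omega
  · -- `p = 7`: residues of `c₆`
    rcases hres₀ with ⟨h, -⟩ | ⟨-, h₀⟩
    · omega
    · rcases hresχ with ⟨h, -⟩ | ⟨-, hχ⟩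
      · omega
      · exact hnsq (isSquare_of_residues_seven _ h₀ hχ hc₆)

/-! ### §4 The binder shape of the input `hTT` (restricted to `p ∈ {5, 7}`, `V₀` additive at `p`) -/

/-- **TORS-TWIST in the binder shape of the hypothesis `hTT`** of
`TwistDegreeStepFiveSevenKP.twistDegreeStepFiveSeven_of_kato_of_twistInputs`, with the two extra premises
the call site holds (`p = 5 ∨ p = 7`, `Addv V₀ p`): PROVED (`torsTwist57`). [cite: Mazur1977, Ch. III §5, Step 1, p. 158] -/
theorem torsTwist57_input :
    ∀ (p : ℕ) [Fact p.Prime] (q : ℕ) [Fact q.Prime] (V₀ : WeierstrassCurve ℚ) [V₀.IsElliptic]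
      [V₀.IsGloballyMinimal], (p = 5 ∨ p = 7) → Addv V₀ p → Irr V₀ p → q ≠ p →
      ¬ IsSquare ((((-1 : ℤ) ^ (q / 2) * q : ℤ)) : ZMod p) →
      (∃ (W' : WeierstrassCurve ℚ) (_ : W'.IsElliptic) (_ : W'.IsGloballyMinimal)
        (P : (W'.baseChange ℚ_[p]).toAffine.Point), IsIsogenous V₀ W' ∧ P ≠ 0 ∧ p • P = 0) →
      ∀ (Vχ : WeierstrassCurve ℚ) [Vχ.IsElliptic] [Vχ.IsGloballyMinimal] (v : VariableChange ℚ),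
      v • V₀.quadraticTwist (((-1 : ℤ) ^ (q / 2) * q : ℤ) : ℚ) = Vχ →
      ∀ (W'' : WeierstrassCurve ℚ) [W''.IsElliptic] [W''.IsGloballyMinimal], IsIsogenous Vχ W'' →
      ∀ Q : (W''.baseChange ℚ_[p]).toAffine.Point, p • Q = 0 → Q = 0 := by
  intro p _ q hq V₀ _ _ hp57 hadd hirr hqp hnsq hW' Vχ _ _ v hv W'' _ _ hiso'' Q hQ
  obtain ⟨W', hE', hM', P, hisoW', hP0, hP⟩ := hW'
  haveI := hE'
  exact torsTwist57 hp57 hq.out hqp V₀ hadd hirr hnsq hisoW' hP0 (by rw [natCast_zsmul]; exact hP) hv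
    hiso'' (by rw [natCast_zsmul]; exact hQ)

end Summit.BirchSwinnertonDyer.BirchSwinnertonDyer.Theorems.TorsTwist

end
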